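import Summits.CriticalPhenomena.CardyFormulaZ2.Theses.CardyQContinuation
import Summits.CriticalPhenomena.CardyFormulaZ2.Theorems.CardyQContinuationIsingJetsConformalStubDesignLowerContinuumPart1
import Summits.CriticalPhenomena.CardyFormulaZ2.Theorems.CardyQContinuationIsingJetsConformalStubDesignLowerContinuumPart2
import Literature.Probability.RandomPlanarGeometry.JordanIndexOne

/-!
# Crux `IsingJetsConformal`, stub `stub_design_lower_continuum`:
# the lower comparison domain of the `n = 0` sandwich in the continuum
# (route `CardyQContinuation`, item stmt-CriticalPhenomena-5560, `n = 0` bridge)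

Given an ORIENTED SQUARE MODEL of every conformal rectangle (the statement of the neighbouring
stub `stub_design_squareModel`, taken as a hypothesis: a homeomorphism `Ψ` of `ℂ` mapping the
model square onto `R`, bottom/top sides onto `R.arc 0` / `R.arc 2`, vertical sides onto
`R.arc 1 ∪ R.arc 3`, such that conformal rectangles with boundary loop uniformly close to
`Ψ ∘ ∂(square)` have index `1`, and Radó continuity of the cross-ratio along sequences of
conformal rectangles with the quarter marks whose boundary loops converge uniformly to
`Ψ ∘ ∂(square)`), we construct for every conformal rectangle `R` and `τ > 0` the LOWER comparison
domain `R⁻` of the `n = 0` sandwich of the crux: a rectilinear polygonal conformal rectangle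
(`R⁻.boundary = polygonLoop l ∘ ρ` for a simple closed polygon `l` whose cyclically consecutive
vertices share a coordinate and an increasing homeomorphism `ρ` of `ℝ` commuting with the unit
translation, `R⁻ = inside of the polygon`), positively oriented, with modulus `τ`-close to that
of `R` (L1), whose black arcs `0, 2` lie outside `closure R` (L3), whose closure misses the free
arcs `R.arc 1 ∪ R.arc 3` (L5), and which off the `sIn`-interior of `R` stays within `sOut` of the
black arcs of `R`, `sOut` a fifth of their distance (L6, L7).

Construction: `R⁻` is the rectilinear shadow (`DesignLowerContinuum.exists_rectilinear_close'`,
part 1) at precision `ε₁` of the image `D⁻ₜ = Ψ((-1+t, 1-t) × (-1-t, 1+t))` of the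
narrower-and-taller model rectangle, where `t, ε₁` come from the model reading of part 2
(`DesignLowerContinuum.exists_lower_geometry`) for `sOut` and the tolerance `min ε η`, `ε` the
orientation tolerance of the square model and `η` the Radó tolerance
(`DesignLowerContinuum.exists_forall_abs_crossRatio_sub_lt`: the sequential Radó clause made
uniform by contradiction, the cross-ratio being independent of the uniformizing datum,
`ConformalRectangle.crossRatio_eq_of_isUniformizing_holds`). No new mathematics. [folklore]
-/

noncomputable section

namespace Summit.CriticalPhenomena.CardyFormulaZ2.Theorems.CardyQContinuation

open Set Metric Filter Topology
open Literature.Probability.RandomPlanarGeometry Literature.Probability.Percolation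
open Summit.CriticalPhenomena.CardyFormulaZ2.Theorems

namespace DesignLowerContinuum

/-- **Radó continuity at the re-modelled quad, uniform form.** If the cross-ratios of ANY
uniformizing data of conformal rectangles `Q m` with the quarter marks converge to the modulus
of `R` whenever `∂(Q m) → Ψ ∘ ∂(square)` uniformly, then for every `τ > 0` there is `η > 0` such
that every conformal rectangle with the quarter marks and boundary loop uniformly `η`-close to
`Ψ ∘ ∂(square)` has modulus `τ`-close to that of `R`, for all uniformizing data of both (by
contradiction along a sequence of counterexamples at precision `1/(m+1)`; the cross-ratio does
not depend on the datum, `ConformalRectangle.crossRatio_eq_of_isUniformizing_holds`). [folklore] -/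
theorem exists_forall_abs_crossRatio_sub_lt (R : ConformalRectangle) (Ψ : ℂ ≃ₜ ℂ)
    (hconv : ∀ Q : ℕ → ConformalRectangle,
      TendstoUniformly (fun m ↦ (Q m).boundary) (unitSquareQuad.map Ψ).boundary atTop →
      (∀ m i, (Q m).mark i = quarterMarks i) →
      ∀ (ψ : ∀ m, ConformalEquiv UpperHalfPlane.upperHalfPlaneSet (Q m).carrier)
        (y : ℕ → Fin 4 → ℝ), (∀ m, (Q m).IsUniformizing (ψ m) (y m)) →
        ∀ (φ : ConformalEquiv UpperHalfPlane.upperHalfPlaneSet R.carrier) (x : Fin 4 → ℝ),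
          R.IsUniformizing φ x → Tendsto (fun m ↦ crossRatio (y m)) atTop (𝓝 (crossRatio x)))
    {τ : ℝ} (hτ : 0 < τ) :
    ∃ η > 0, ∀ Q : ConformalRectangle, (∀ i, Q.mark i = quarterMarks i) →
      (∀ s, dist (Q.boundary s) ((unitSquareQuad.map Ψ).boundary s) ≤ η) →
      ∀ (φ : ConformalEquiv UpperHalfPlane.upperHalfPlaneSet R.carrier) (x : Fin 4 → ℝ),
        R.IsUniformizing φ x →
        ∀ (φ' : ConformalEquiv UpperHalfPlane.upperHalfPlaneSet Q.carrier) (x' : Fin 4 → ℝ),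
          Q.IsUniformizing φ' x' → |crossRatio x' - crossRatio x| < τ := by
  by_contra hcon
  push Not at hcon
  choose Q hQm hQc φ x hφ φ' x' hφ' hfar using fun m : ℕ => hcon (1 / ((m : ℝ) + 1)) (by positivity)
  obtain ⟨φ₀, x₀, h₀⟩ := MarkedDomain.exists_isUniformizing_holds R
  have hunif : TendstoUniformly (fun m ↦ (Q m).boundary) (unitSquareQuad.map Ψ).boundary atTop := by
    rw [Metric.tendstoUniformly_iff]
    intro e he
    obtain ⟨N, hN⟩ := exists_nat_one_div_lt he
    filter_upwards [eventually_ge_atTop N] with m hm s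
    rw [dist_comm]
    calc dist ((Q m).boundary s) ((unitSquareQuad.map Ψ).boundary s) ≤ 1 / ((m : ℝ) + 1) := hQc m s
      _ ≤ 1 / ((N : ℝ) + 1) :=
          one_div_le_one_div_of_le (by positivity) (by exact_mod_cast Nat.add_le_add_right hm 1)
      _ < e := hN
  have hlim := hconv Q hunif hQm φ' x' hφ' φ₀ x₀ h₀
  obtain ⟨m, hm⟩ := (((Metric.tendsto_nhds.1 hlim) τ hτ).exists : ∃ m, dist (crossRatio (x' m)) (crossRatio x₀) < τ)
  rw [Real.dist_eq] at hm
  have heq : crossRatio (x m) = crossRatio x₀ :=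
    ConformalRectangle.crossRatio_eq_of_isUniformizing_holds (hφ m) h₀
  have := hfar m
  rw [heq] at this
  exact absurd hm (not_lt.2 this)

/-- **Opposite arcs are `5 sOut` apart**: with `sOut` a fifth of the distance between the compact
disjoint arcs `R.arc 0`, `R.arc 2`, no point is within `2 sOut` of both. [folklore] -/
theorem exists_sOut (R : ConformalRectangle) :
    ∃ sOut > 0, ∀ z : ℂ, infDist z (R.arc 0) ≤ 2 * sOut → infDist z (R.arc 2) ≤ 2 * sOut → False := by
  obtain ⟨r, hr, hsep⟩ := MarkedDomain.exists_pos_forall_lt_dist_arc R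
  refine ⟨r / 5, by positivity, fun z hz0 hz2 => ?_⟩
  obtain ⟨a, ha, hda⟩ := (R.isCompact_arc 0).exists_infDist_eq_dist ⟨_, R.pt_mem_arc_self 0⟩ z
  obtain ⟨b, hb, hdb⟩ := (R.isCompact_arc 2).exists_infDist_eq_dist ⟨_, R.pt_mem_arc_self 2⟩ z
  have h1 := hsep a ha b hb
  have h2 := dist_triangle a z b
  rw [dist_comm a z, ← hda, ← hdb] at h2
  linarith

end DesignLowerContinuum

open DesignLowerContinuum in
/-- **Registered stub `stub_design_lower_continuum`** of the `n = 0` bridge of the crux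
`IsingJetsConformal` (stmt-CriticalPhenomena-5560): from an oriented square model with Radó
continuity (the statement of `stub_design_squareModel`), the lower comparison domain `R⁻` of the
sandwich — a positively oriented rectilinear polygonal conformal rectangle with modulus `τ`-close
to that of `R`, black arcs outside `closure R`, closure off the free arcs of `R`, and off the
`sIn`-interior of `R` within `sOut` of the black arcs of `R`. See the module docstring.
[folklore] -/
theorem stub_design_lower_continuum : ((∀ R : Literature.Probability.RandomPlanarGeometry.ConformalRectangle, ∃ Ψ : ℂ ≃ₜ ℂ, Ψ '' Literature.Probability.Percolation.unitSquareQuad.carrier = R.carrier ∧ Ψ '' Literature.Probability.Percolation.unitSquareQuad.arc 0 = R.arc 0 ∧ Ψ '' Literature.Probability.Percolation.unitSquareQuad.arc 2 = R.arc 2 ∧ Ψ '' (Literature.Probability.Percolation.unitSquareQuad.arc 1 ∪ Literature.Probability.Percolation.unitSquareQuad.arc 3) = R.arc 1 ∪ R.arc 3 ∧ (∃ ε : ℝ, 0 < ε ∧ ∀ P : Literature.Probability.RandomPlanarGeometry.ConformalRectangle, (∀ s : ℝ, dist (P.boundary s) ((Literature.Probability.Percolation.unitSquareQuad.map Ψ).boundary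 s) ≤ ε) → ∀ z ∈ P.carrier, P.toJordanDomain.index z = 1) ∧ (∀ Q : ℕ → Literature.Probability.RandomPlanarGeometry.ConformalRectangle, TendstoUniformly (fun m ↦ (Q m).boundary) (Literature.Probability.Percolation.unitSquareQuad.map Ψ).boundary Filter.atTop → (∀ m i, (Q m).mark i = Literature.Probability.Percolation.quarterMarks i) → ∀ (ψ : ∀ m, Literature.Probability.RandomPlanarGeometry.ConformalEquiv UpperHalfPlane.upperHalfPlaneSet (Q m).carrier) (y : ℕ → Fin 4 → ℝ), (∀ m, (Q m).IsUniformizing (ψ m) (y m)) → ∀ (φ : Literature.Probability.RandomPlanarGeometry.ConformalEquiv UpperHalfPlane.upperHalfPlaneSet R.carrier) (x : Fin 4 → ℝ), R.IsUniformizing φ x → Filter.Tendsto (fun m ↦ Literature.Probability.RandomPlanarGeometry.crossRatio (y m)) Filter.atTop (nhds (Literature.Probability.RandomPlanarGeometry.crossRatio x)))) → (∀ (R : Literature.Probability.RandomPlanarGeometry.ConformalRectangle) (τ : ℝ), 0 < τ → ∃ (Rm : Literature.Probability.RandomPlanarGeometry.ConformalRectangle) (l : List ℂ) (h : Literature.Probability.RandomPlanarGeometry.IsSimpleClosedPolygon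 l) (ρ : ℝ → ℝ), (∀ (k : ℕ) (hk : k < l.length), (l[k]).re = (l[(k + 1) % l.length]'(Nat.mod_lt _ h.pos)).re ∨ (l[k]).im = (l[(k + 1) % l.length]'(Nat.mod_lt _ h.pos)).im) ∧ Continuous ρ ∧ StrictMono ρ ∧ Function.Surjective ρ ∧ (∀ s : ℝ, ρ (s + 1) = ρ s + 1) ∧ Rm.boundary = Literature.Probability.RandomPlanarGeometry.polygonLoop l ∘ ρ ∧ Rm.carrier = (Literature.Probability.RandomPlanarGeometry.polygonDomain l h).carrier ∧ (∀ z ∈ Rm.carrier, Rm.toJordanDomain.index z = 1) ∧ (∀ (φ : Literature.Probability.RandomPlanarGeometry.ConformalEquiv UpperHalfPlane.upperHalfPlaneSet R.carrier) (x : Fin 4 → ℝ), R.IsUniformizing φ x → ∀ (φ' : Literature.Probability.RandomPlanarGeometry.ConformalEquiv UpperHalfPlane.upperHalfPlaneSet Rm.carrier) (x' : Fin 4 → ℝ), Rm.IsUniformizing φ' x' → |Literature.Probability.RandomPlanarGeometry.crossRatio x' - Literature.Probability.RandomPlanarGeometry.crossRatio x| < τ) ∧ Rm.arc 0 ∪ Rm.arc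 2 ⊆ (closure R.carrier)ᶜ ∧ closure Rm.carrier ∩ (R.arc 1 ∪ R.arc 3) = ∅ ∧ (∃ sIn sOut : ℝ, 0 < sIn ∧ 0 < sOut ∧ closure Rm.carrier \ {z | z ∈ R.carrier ∧ sIn ≤ Metric.infDist z (frontier R.carrier)} ⊆ {z | Metric.infDist z (R.arc 0) < sOut} ∪ {z | Metric.infDist z (R.arc 2) < sOut} ∧ Rm.arc 0 ⊆ {z | Metric.infDist z (R.arc 0) < sOut} ∧ Rm.arc 2 ⊆ {z | Metric.infDist z (R.arc 2) < sOut} ∧ ∀ z : ℂ, Metric.infDist z (R.arc 0) ≤ 2 * sOut → Metric.infDist z (R.arc 2) ≤ 2 * sOut → False))) := by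
  intro hS R τ hτ
  obtain ⟨Ψ, hcar, h0, h2, h13, ⟨ε, hε, hidx⟩, hconv⟩ := hS R
  -- the Radó tolerance and the separation of the black arcs
  obtain ⟨η, hη, hcr⟩ := exists_forall_abs_crossRatio_sub_lt R Ψ hconv hτ
  obtain ⟨sOut, hsOut, hsep⟩ := exists_sOut R
  -- the model geometry: the narrow-and-tall rectangle `D⁻ₜ` and the precision `ε₁`
  obtain ⟨t, ht, ht2, ε₁, hε₁, hgeo⟩ := exists_lower_geometry hcar h0 h2 h13 hsOut
    (ε := min ε η) (by positivity)
  -- the rectilinear shadow of `D⁻ₜ`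
  obtain ⟨P, l, hl, ρ, hrect, hρc, hρm, hρs, hρ1, hbd, hcarP, hmarkP, hclose⟩ :=
    exists_rectilinear_close'
      (perturbQuad Ψ (-1 + t) (1 - t) (-1 - t) (1 + t) (by linarith) (by linarith)) hε₁
  have hmarkQ : ∀ i, P.mark i = quarterMarks i := fun i => by rw [hmarkP, perturbQuad_mark]
  obtain ⟨hnear, hL3, hL5, sIn, hsIn, hL6, hL7a, hL7b⟩ := hgeo P hmarkQ hclose
  refine ⟨P, l, hl, ρ, hrect, hρc, hρm, hρs, hρ1, hbd, hcarP, ?_, ?_, hL3, hL5, sIn, sOut, hsIn,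
    hsOut, hL6, hL7a, hL7b, hsep⟩
  · -- positive orientation
    exact hidx P fun s => (hnear s).trans (min_le_left _ _)
  · -- (L1): the modulus of `R⁻` is `τ`-close to that of `R`
    intro φ x hφx φ' x' hφx'
    exact hcr P hmarkQ (fun s => (hnear s).trans (min_le_right _ _)) φ x hφx φ' x' hφx'

end Summit.CriticalPhenomena.CardyFormulaZ2.Theorems.CardyQContinuation
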